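import Summits.Ventures.WeilGRH.TwoPrimeReflectionRungs
import Summits.Ventures.WeilGRH.ReflectionRungsSmallModuli
import HarnessLib

/-!
# GRH arm (rh-explicit, venture WeilGRH): two-prime reflection rungs by the values `χ(2)`, `χ(3)`

Per-class instances of `weilPositivityOnChar_fiftynine_of_curve` / `weilPositivityOnChar_log_two_of_curve`
(`TwoPrimeReflectionRungs.lean`) for characters of conductor `q ≤ 20` and beyond, keyed by algebraic or
metric facts about `χ(2)` (which fixes `σ = ‖1 − χ(2)‖²`) and `χ(3)` (which fixes the budget
`δ ≥ (log 3/√3)‖1 − χ(3)‖`). With the census (`CHARACTERS.md`, Conrey labels):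

* `χ(2) = −1, χ(3) = 1`, `q ≥ 8`: rungs `59/100` AND `log 2` — classes `11.10`, `13.12`;
* `χ(3) = 1`, `‖1 − χ(2)‖² ≥ 2`, `q ≥ 13`: rung `log 2` — `13.5/13.8` (and `13.12`);
* `3 ∣ q`, `‖1 − χ(2)‖² ≥ 2`, `q ≥ 15`: rung `59/100` — `15.2/15.8`;
* `χ(2) = −1`, any `χ(3)`, `q ≥ 17`: rung `59/100` — `17.4/17.13`, `19.18`; `q ≥ 25`: rung `log 2`;
* `χ(2), χ(3)` nontrivial cube roots of unity, `q ≥ 19`: rung `59/100` — `19.7/19.11`;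
* `χ(2), χ(3)` primitive sixth roots of unity, `q ≥ 19`: rung `59/100` — `19.8/19.12`;
* `‖1 − χ(3)‖ ≤ 2/5`, `q ≥ 17`: rung `59/100` — `17.3/17.6` (`χ(3) = e(±1/16)`);
* `‖1 − χ(3)‖² ≤ 2`, `‖1 − χ(2)‖² ≥ 3`, `q ≥ 17`: rung `59/100` — `17.4/17.13`, `17.10/17.12`, `19.9/19.17`,
  `19.14/19.15`;
* `‖1 − χ(3)‖ ≤ 7/10`, `‖1 − χ(2)‖² ≥ 3/2`, `q ≥ 19`: rung `59/100` — `19.6/19.16`;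
* `‖1 − χ(3)‖ ≤ 4/5`, `‖1 − χ(2)‖² ≥ 2`, `q ≥ 17`: rung `59/100` — `17.2/17.9`.

The hypotheses on `χ(2), χ(3)` are to be discharged from the census bridge (`ConreyRowBridge.lean`) per
character; the budgets use `log 13 > log(6⁴/10²)`, `log 17 > log(3³·5/2³)`, `log 19 > log(3·5²/2²)`.

## References

* A. Weil (1952), (11) and the «lemme» p. 262; H. Yoshida (1992) §6.
-/

noncomputable section

open Complex Filter Set MeasureTheory
open scoped Real Topology ComplexConjugate

namespace Summit.Ventures.WeilGRH

open Literature.NumberTheory.LFunctions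

/-! ## Logarithms of `13`, `17`, `19` from below -/

/-- `2.56 ≤ log 13` (`13 > 12.96 = 2²·3⁴/5²`). [folklore] -/
theorem log_thirteen_ge : (2.56 : ℝ) ≤ Real.log 13 := by
  have h : Real.log (2 ^ 2 * 3 ^ 4 / 5 ^ 2) ≤ Real.log 13 :=
    Real.log_le_log (by positivity) (by norm_num)
  rw [Real.log_div (by norm_num) (by norm_num), Real.log_mul (by norm_num) (by norm_num),
    Real.log_pow, Real.log_pow, Real.log_pow] at h
  push_cast at h
  linarith [Real.log_two_gt_d9, Real.log_three_gt_d9, Real.log_five_lt_d9]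

/-- `2.825 ≤ log 17` (`17 > 16.875 = 3³·5/2³`). [folklore] -/
theorem log_seventeen_ge : (2.825 : ℝ) ≤ Real.log 17 := by
  have h : Real.log (3 ^ 3 * 5 / 2 ^ 3) ≤ Real.log 17 :=
    Real.log_le_log (by positivity) (by norm_num)
  rw [Real.log_div (by norm_num) (by norm_num), Real.log_mul (by norm_num) (by norm_num),
    Real.log_pow, Real.log_pow] at h
  push_cast at h
  linarith [Real.log_two_lt_d9, Real.log_three_gt_d9, Real.log_five_gt_d9]

/-- `2.93 ≤ log 19` (`19 > 18.75 = 3·5²/2²`). [folklore] -/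
theorem log_nineteen_ge : (2.93 : ℝ) ≤ Real.log 19 := by
  have h : Real.log (3 * 5 ^ 2 / 2 ^ 2) ≤ Real.log 19 :=
    Real.log_le_log (by positivity) (by norm_num)
  rw [Real.log_div (by norm_num) (by norm_num), Real.log_mul (by norm_num) (by norm_num),
    Real.log_pow, Real.log_pow] at h
  push_cast at h
  linarith [Real.log_two_lt_d9, Real.log_three_gt_d9, Real.log_five_gt_d9]

variable {q : ℕ}

/-! ## `χ(3) = 1` -/

/-- **`χ(2) = −1`, `χ(3) = 1`, `q ≥ 8` ⟹ rung `59/100`** (classes `11.10`, `13.12`).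
[cite: Weil1952FormulesExplicites, the «lemme» p. 262; Yoshida1992 §6] -/
theorem weilPositivityOnChar_fiftynine_of_chi_two_neg_one_chi_three_one (hq : 8 ≤ q)
    (χ : DirichletCharacter ℂ q) (h2 : χ (2 : ZMod q) = -1) (h3 : χ (3 : ZMod q) = 1) :
    WeilPositivityOnChar χ (59 / 100) := by
  have hq1 : q ≠ 1 := by omega
  haveI : NeZero q := ⟨by omega⟩
  have hBq : (2.079 : ℝ) ≤ Real.log q := by
    have h8 : Real.log 8 ≤ Real.log q := Real.log_le_log (by norm_num) (by exact_mod_cast hq)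
    rw [show (8 : ℝ) = 2 ^ 3 by norm_num, Real.log_pow] at h8
    push_cast at h8
    linarith [Real.log_two_gt_d9]
  have hσ : ‖1 - χ (2 : ZMod q)‖ ^ 2 = 4 := by rw [h2]; norm_num
  have hδ : Real.log 3 / Real.sqrt 3 * ‖1 - χ (3 : ZMod q)‖ ≤ 0 := by
    rw [h3, sub_self, norm_zero, mul_zero]
  exact weilPositivityOnChar_fiftynine_of_curve hq1 χ hBq (by norm_num) hδ
    hσ.symm.le hσ.le (by norm_num) le_rfl (by norm_num) (by norm_num)

/-- **`χ(2) = −1`, `χ(3) = 1`, `q ≥ 8` ⟹ rung `log 2`** (classes `11.10`, `13.12`).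
[cite: Weil1952FormulesExplicites, the «lemme» p. 262; Yoshida1992 §6] -/
theorem weilPositivityOnChar_log_two_of_chi_two_neg_one_chi_three_one (hq : 8 ≤ q)
    (χ : DirichletCharacter ℂ q) (h2 : χ (2 : ZMod q) = -1) (h3 : χ (3 : ZMod q) = 1) :
    WeilPositivityOnChar χ (Real.log 2) := by
  have hq1 : q ≠ 1 := by omega
  haveI : NeZero q := ⟨by omega⟩
  have hBq : (2.079 : ℝ) ≤ Real.log q := by
    have h8 : Real.log 8 ≤ Real.log q := Real.log_le_log (by norm_num) (by exact_mod_cast hq)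
    rw [show (8 : ℝ) = 2 ^ 3 by norm_num, Real.log_pow] at h8
    push_cast at h8
    linarith [Real.log_two_gt_d9]
  have hσ : ‖1 - χ (2 : ZMod q)‖ ^ 2 = 4 := by rw [h2]; norm_num
  have hδ : Real.log 3 / Real.sqrt 3 * ‖1 - χ (3 : ZMod q)‖ ≤ 0 := by
    rw [h3, sub_self, norm_zero, mul_zero]
  exact weilPositivityOnChar_log_two_of_curve hq1 χ hBq (by norm_num) hδ
    hσ.symm.le hσ.le (by norm_num) le_rfl (by norm_num) (by norm_num)

/-- **`χ(3) = 1`, `‖1 − χ(2)‖² ≥ 2`, `q ≥ 13` ⟹ rung `log 2`** (classes `13.5/13.8`, `13.12`).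
[cite: Weil1952FormulesExplicites, the «lemme» p. 262; Yoshida1992 §6] -/
theorem weilPositivityOnChar_log_two_of_chi_three_one (hq : 13 ≤ q) (χ : DirichletCharacter ℂ q)
    (h2 : 2 ≤ ‖1 - χ (2 : ZMod q)‖ ^ 2) (h3 : χ (3 : ZMod q) = 1) :
    WeilPositivityOnChar χ (Real.log 2) := by
  have hq1 : q ≠ 1 := by omega
  haveI : NeZero q := ⟨by omega⟩
  have hBq : (2.56 : ℝ) ≤ Real.log q :=
    log_thirteen_ge.trans (Real.log_le_log (by norm_num) (by exact_mod_cast hq))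
  have hδ : Real.log 3 / Real.sqrt 3 * ‖1 - χ (3 : ZMod q)‖ ≤ 0 := by
    rw [h3, sub_self, norm_zero, mul_zero]
  exact weilPositivityOnChar_log_two_of_curve hq1 χ hBq (by norm_num) hδ
    h2 (normSq_one_sub_char_le_four χ) (by norm_num) le_rfl (by norm_num) (by norm_num)

/-! ## `χ(3) = 0` and `χ(2)` off `1` -/

/-- **`3 ∣ q`, `‖1 − χ(2)‖² ≥ 2`, `q ≥ 15` ⟹ rung `59/100`** (classes `15.2/15.8`).
[cite: Weil1952FormulesExplicites, the «lemme» p. 262; Yoshida1992 §6] -/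
theorem weilPositivityOnChar_fiftynine_of_three_dvd_of_two_le (hq : 15 ≤ q) (h3q : 3 ∣ q)
    (χ : DirichletCharacter ℂ q) (h2 : 2 ≤ ‖1 - χ (2 : ZMod q)‖ ^ 2) :
    WeilPositivityOnChar χ (59 / 100) := by
  have hq1 : q ≠ 1 := by omega
  haveI : NeZero q := ⟨by omega⟩
  have hχ3 : χ (3 : ZMod q) = 0 := by
    refine χ.map_nonunit fun hunit ↦ ?_
    have hcop := (ZMod.isUnit_iff_coprime 3 q).1 (by exact_mod_cast hunit)
    have := Nat.Coprime.eq_one_of_dvd hcop h3q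
    omega
  have hBq : (2.705 : ℝ) ≤ Real.log q := by
    have h := Real.log_le_log (by norm_num) (by exact_mod_cast hq : (15 : ℝ) ≤ q)
    rw [show (15 : ℝ) = 3 * 5 by norm_num, Real.log_mul (by norm_num) (by norm_num)] at h
    linarith [Real.log_three_gt_d9, Real.log_five_gt_d9]
  have hδ : Real.log 3 / Real.sqrt 3 * ‖1 - χ (3 : ZMod q)‖ ≤ 0.6343 := by
    rw [hχ3, sub_zero, norm_one, mul_one]; exact kthree_le
  exact weilPositivityOnChar_fiftynine_of_curve hq1 χ hBq (by norm_num) hδ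
    h2 (normSq_one_sub_char_le_four χ) (by norm_num) le_rfl (by norm_num) (by norm_num)

/-! ## `χ(2) = −1`, any `χ(3)` -/

/-- **`χ(2) = −1`, `q ≥ 17` ⟹ rung `59/100`** (classes `17.4/17.13`, `19.18`; `δ = 1.2686`).
[cite: Weil1952FormulesExplicites, the «lemme» p. 262; Yoshida1992 §6] -/
theorem weilPositivityOnChar_fiftynine_of_chi_two_neg_one (hq : 17 ≤ q)
    (χ : DirichletCharacter ℂ q) (h2 : χ (2 : ZMod q) = -1) :
    WeilPositivityOnChar χ (59 / 100) := by
  have hq1 : q ≠ 1 := by omega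
  haveI : NeZero q := ⟨by omega⟩
  have hBq : (2.825 : ℝ) ≤ Real.log q :=
    log_seventeen_ge.trans (Real.log_le_log (by norm_num) (by exact_mod_cast hq))
  have hσ : ‖1 - χ (2 : ZMod q)‖ ^ 2 = 4 := by rw [h2]; norm_num
  have hδ : Real.log 3 / Real.sqrt 3 * ‖1 - χ (3 : ZMod q)‖ ≤ 1.2686 := by
    have := mul_le_mul kthree_le (norm_one_sub_char_three_le χ) (norm_nonneg _) (by norm_num)
    linarith
  exact weilPositivityOnChar_fiftynine_of_curve hq1 χ hBq (by norm_num) hδ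
    hσ.symm.le hσ.le (by norm_num) le_rfl (by norm_num) (by norm_num)

/-- **`χ(2) = −1`, `q ≥ 25` ⟹ rung `log 2`** (`δ = 1.2686`, `B = 3.218 ≤ 2 log 5`).
[cite: Weil1952FormulesExplicites, the «lemme» p. 262; Yoshida1992 §6] -/
theorem weilPositivityOnChar_log_two_of_chi_two_neg_one (hq : 25 ≤ q)
    (χ : DirichletCharacter ℂ q) (h2 : χ (2 : ZMod q) = -1) :
    WeilPositivityOnChar χ (Real.log 2) := by
  have hq1 : q ≠ 1 := by omega
  haveI : NeZero q := ⟨by omega⟩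
  have hBq : (3.218 : ℝ) ≤ Real.log q := by
    have h := Real.log_le_log (by norm_num) (by exact_mod_cast hq : (25 : ℝ) ≤ q)
    rw [show (25 : ℝ) = 5 ^ 2 by norm_num, Real.log_pow] at h
    push_cast at h
    linarith [Real.log_five_gt_d9]
  have hσ : ‖1 - χ (2 : ZMod q)‖ ^ 2 = 4 := by rw [h2]; norm_num
  have hδ : Real.log 3 / Real.sqrt 3 * ‖1 - χ (3 : ZMod q)‖ ≤ 1.2686 := by
    have := mul_le_mul kthree_le (norm_one_sub_char_three_le χ) (norm_nonneg _) (by norm_num)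
    linarith
  exact weilPositivityOnChar_log_two_of_curve hq1 χ hBq (by norm_num) hδ
    hσ.symm.le hσ.le (by norm_num) le_rfl (by norm_num) (by norm_num)

/-! ## Roots of unity of order `3` and `6` at both primes -/

/-- **`χ(2)`, `χ(3)` nontrivial cube roots of unity, `q ≥ 19` ⟹ rung `59/100`** (classes `19.7/19.11`;
`σ = 3`, `(log 3/√3)·√3 = log 3 ≤ 1.0987`). [cite: Weil1952FormulesExplicites, the «lemme» p. 262; Yoshida1992 §6] -/
theorem weilPositivityOnChar_fiftynine_of_cube_cube (hq : 19 ≤ q) (χ : DirichletCharacter ℂ q)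
    (h2 : χ (2 : ZMod q) ^ 3 = 1) (h2' : χ (2 : ZMod q) ≠ 1)
    (h3 : χ (3 : ZMod q) ^ 3 = 1) (h3' : χ (3 : ZMod q) ≠ 1) :
    WeilPositivityOnChar χ (59 / 100) := by
  have hq1 : q ≠ 1 := by omega
  haveI : NeZero q := ⟨by omega⟩
  have hBq : (2.93 : ℝ) ≤ Real.log q :=
    log_nineteen_ge.trans (Real.log_le_log (by norm_num) (by exact_mod_cast hq))
  have hσ : ‖1 - χ (2 : ZMod q)‖ ^ 2 = 3 := normSq_one_sub_of_cube_eq_one h2 h2'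
  have hσ3 : ‖1 - χ (3 : ZMod q)‖ ^ 2 = 3 := normSq_one_sub_of_cube_eq_one h3 h3'
  have hδ : Real.log 3 / Real.sqrt 3 * ‖1 - χ (3 : ZMod q)‖ ≤ 1.0987 := by
    have hs : Real.sqrt 3 * Real.sqrt 3 = 3 := Real.mul_self_sqrt (by norm_num)
    have hn : ‖1 - χ (3 : ZMod q)‖ = Real.sqrt 3 := by
      rw [← Real.sqrt_sq (norm_nonneg _), hσ3]
    rw [hn, div_mul_cancel₀ _ (by positivity)]
    linarith [Real.log_three_lt_d9]
  exact weilPositivityOnChar_fiftynine_of_curve hq1 χ hBq (by norm_num) hδ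
    hσ.symm.le hσ.le (by norm_num) (by norm_num) (by norm_num) (by norm_num)

/-- **`χ(2)`, `χ(3)` primitive sixth roots of unity (`z² − z + 1 = 0`), `q ≥ 19` ⟹ rung `59/100`**
(classes `19.8/19.12`; `σ = 1`, `δ = k₃'`). [cite: Weil1952FormulesExplicites, the «lemme» p. 262; Yoshida1992 §6] -/
theorem weilPositivityOnChar_fiftynine_of_sixth_sixth (hq : 19 ≤ q) (χ : DirichletCharacter ℂ q)
    (h2 : χ (2 : ZMod q) ^ 2 - χ (2 : ZMod q) + 1 = 0)
    (h3 : χ (3 : ZMod q) ^ 2 - χ (3 : ZMod q) + 1 = 0) :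
    WeilPositivityOnChar χ (59 / 100) := by
  have hq1 : q ≠ 1 := by omega
  haveI : NeZero q := ⟨by omega⟩
  have hBq : (2.93 : ℝ) ≤ Real.log q :=
    log_nineteen_ge.trans (Real.log_le_log (by norm_num) (by exact_mod_cast hq))
  have hσ : ‖1 - χ (2 : ZMod q)‖ ^ 2 = 1 := normSq_one_sub_of_sq_sub_self_add_one h2
  have hσ3 : ‖1 - χ (3 : ZMod q)‖ ^ 2 = 1 := normSq_one_sub_of_sq_sub_self_add_one h3
  have hδ : Real.log 3 / Real.sqrt 3 * ‖1 - χ (3 : ZMod q)‖ ≤ 0.6343 := by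
    have hn : ‖1 - χ (3 : ZMod q)‖ = 1 := by
      rw [← Real.sqrt_sq (norm_nonneg _), hσ3, Real.sqrt_one]
    rw [hn, mul_one]; exact kthree_le
  exact weilPositivityOnChar_fiftynine_of_curve hq1 χ hBq (by norm_num) hδ
    hσ.symm.le hσ.le (by norm_num) (by norm_num) (by norm_num) (by norm_num)

/-! ## Metric hypotheses on `χ(3)` -/

/-- **`‖1 − χ(3)‖ ≤ 2/5`, `q ≥ 17` ⟹ rung `59/100`** (classes `17.3/17.6`: `χ(3) = e(±1/16)`; `δ = 0.2538`).
[cite: Weil1952FormulesExplicites, the «lemme» p. 262; Yoshida1992 §6] -/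
theorem weilPositivityOnChar_fiftynine_of_chi_three_near_one (hq : 17 ≤ q)
    (χ : DirichletCharacter ℂ q) (h3 : ‖1 - χ (3 : ZMod q)‖ ≤ 2 / 5) :
    WeilPositivityOnChar χ (59 / 100) := by
  have hq1 : q ≠ 1 := by omega
  haveI : NeZero q := ⟨by omega⟩
  have hBq : (2.825 : ℝ) ≤ Real.log q :=
    log_seventeen_ge.trans (Real.log_le_log (by norm_num) (by exact_mod_cast hq))
  have hδ : Real.log 3 / Real.sqrt 3 * ‖1 - χ (3 : ZMod q)‖ ≤ 0.2538 := by
    have := mul_le_mul kthree_le h3 (norm_nonneg _) (by norm_num)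
    linarith
  exact weilPositivityOnChar_fiftynine_of_curve hq1 χ hBq (by norm_num) hδ
    (sq_nonneg _) (normSq_one_sub_char_le_four χ) le_rfl le_rfl (by norm_num) (by norm_num)

/-- **`‖1 − χ(3)‖² ≤ 2`, `‖1 − χ(2)‖² ≥ 3`, `q ≥ 17` ⟹ rung `59/100`** (classes `17.4/17.13`, `17.10/17.12`,
`19.9/19.17`, `19.14/19.15`; `δ = 0.8971 ≥ k₃'√2`). [cite: Weil1952FormulesExplicites, the «lemme» p. 262; Yoshida1992 §6] -/
theorem weilPositivityOnChar_fiftynine_of_sq_le_two (hq : 17 ≤ q) (χ : DirichletCharacter ℂ q)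
    (h2 : 3 ≤ ‖1 - χ (2 : ZMod q)‖ ^ 2) (h3 : ‖1 - χ (3 : ZMod q)‖ ^ 2 ≤ 2) :
    WeilPositivityOnChar χ (59 / 100) := by
  have hq1 : q ≠ 1 := by omega
  haveI : NeZero q := ⟨by omega⟩
  have hBq : (2.825 : ℝ) ≤ Real.log q :=
    log_seventeen_ge.trans (Real.log_le_log (by norm_num) (by exact_mod_cast hq))
  have hx : ‖1 - χ (3 : ZMod q)‖ ≤ 1.41422 := by
    nlinarith [norm_nonneg (1 - χ (3 : ZMod q)), h3]
  have hδ : Real.log 3 / Real.sqrt 3 * ‖1 - χ (3 : ZMod q)‖ ≤ 0.8971 := by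
    have := mul_le_mul kthree_le hx (norm_nonneg _) (by norm_num)
    linarith
  exact weilPositivityOnChar_fiftynine_of_curve hq1 χ hBq (by norm_num) hδ
    h2 (normSq_one_sub_char_le_four χ) (by norm_num) le_rfl (by norm_num) (by norm_num)

/-- **`‖1 − χ(3)‖ ≤ 7/10`, `‖1 − χ(2)‖² ≥ 3/2`, `q ≥ 19` ⟹ rung `59/100`** (classes `19.6/19.16`;
`δ = 0.44401`). [cite: Weil1952FormulesExplicites, the «lemme» p. 262; Yoshida1992 §6] -/
theorem weilPositivityOnChar_fiftynine_of_chi_three_le (hq : 19 ≤ q) (χ : DirichletCharacter ℂ q)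
    (h2 : 3 / 2 ≤ ‖1 - χ (2 : ZMod q)‖ ^ 2) (h3 : ‖1 - χ (3 : ZMod q)‖ ≤ 7 / 10) :
    WeilPositivityOnChar χ (59 / 100) := by
  have hq1 : q ≠ 1 := by omega
  haveI : NeZero q := ⟨by omega⟩
  have hBq : (2.93 : ℝ) ≤ Real.log q :=
    log_nineteen_ge.trans (Real.log_le_log (by norm_num) (by exact_mod_cast hq))
  have hδ : Real.log 3 / Real.sqrt 3 * ‖1 - χ (3 : ZMod q)‖ ≤ 0.44401 := by
    have := mul_le_mul kthree_le h3 (norm_nonneg _) (by norm_num)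
    linarith
  exact weilPositivityOnChar_fiftynine_of_curve hq1 χ hBq (by norm_num) hδ
    h2 (normSq_one_sub_char_le_four χ) (by norm_num) le_rfl (by norm_num) (by norm_num)

/-- **`‖1 − χ(3)‖ ≤ 4/5`, `‖1 − χ(2)‖² ≥ 2`, `q ≥ 17` ⟹ rung `59/100`** (classes `17.2/17.9`: `χ(2) = ±i`,
`χ(3) = e(∓1/8)`; `δ = 0.50744`). [cite: Weil1952FormulesExplicites, the «lemme» p. 262; Yoshida1992 §6] -/
theorem weilPositivityOnChar_fiftynine_of_chi_three_le' (hq : 17 ≤ q) (χ : DirichletCharacter ℂ q)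
    (h2 : 2 ≤ ‖1 - χ (2 : ZMod q)‖ ^ 2) (h3 : ‖1 - χ (3 : ZMod q)‖ ≤ 4 / 5) :
    WeilPositivityOnChar χ (59 / 100) := by
  have hq1 : q ≠ 1 := by omega
  haveI : NeZero q := ⟨by omega⟩
  have hBq : (2.825 : ℝ) ≤ Real.log q :=
    log_seventeen_ge.trans (Real.log_le_log (by norm_num) (by exact_mod_cast hq))
  have hδ : Real.log 3 / Real.sqrt 3 * ‖1 - χ (3 : ZMod q)‖ ≤ 0.50744 := by
    have := mul_le_mul kthree_le h3 (norm_nonneg _) (by norm_num)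
    linarith
  exact weilPositivityOnChar_fiftynine_of_curve hq1 χ hBq (by norm_num) hδ
    h2 (normSq_one_sub_char_le_four χ) (by norm_num) le_rfl (by norm_num) (by norm_num)

end Summit.Ventures.WeilGRH
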